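import Summits.QuantumFields.YangMills.Theorems.BalabanUVNodesN15KingModelTwoSpacingOneDatum
import Summits.QuantumFields.YangMills.Theorems.BalabanUVNodesN15KingModelContourSteps
import HarnessLib

/-!
# BalabanUVNodes ∕ N15 — THE KING-MODEL RUNG, CURVED EDITION (PART Κ-b): KING 1986 **(3.72) BY NAME** — THE TWO-SPACING η-RATE OF THE
# BACKGROUND DRESSING `U(B(Γ))` ALONG KING's NESTED BLOCK CONTOURS (2.12), inhabiting the typer's schema `SlicePropagator.Ineq372Printed`
# (Track A, DAG node N15 = NE2; FAN-OUT v1.1 §N15 s3 «KING-MODEL RUNG … + the one-line statement of what the curved case adds»)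

HONEST FRAMING.  Count-neutral (cell `pub-ymgap`, seat `pub-ymgap-dag-n15-e` g24; `--supports stmt-QuantumFields-27366 --as helper` = K3⁸
`SpineGivenEndpointR13SepCoPHV`).  TEMPLATE LITERATURE: C. King's U(1)-Higgs MODEL on finite tori ([King1986] = C. King, *The U(1) Higgs model. I. The
continuum limit*, Commun. Math. Phys. **102** (1986) 649–677), an ELEMENTARY printed bound of §3.3 proved here for King's own objects; NOT Bałaban's
non-abelian `G(U)` of [B9] (the «road (c)» edition is dag-n15-c's pen); the rider of ruling №252 (non-abelian `G(U)` dressing of NE2) is untouched; NOT a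
node discharge; nothing continuum ∕ ℝ⁴ ∕ OS ∕ mass-gap ∕ Clay.  0 `sorry`; standard axioms.  Page renders READ AS IMAGES for every quotation:
`run/shared/lean/pub/pub-balaban/b2b-balaban-template/king-renders/1986-cmp102-king-u1-higgs-I-p005-x2.png` (p. 653), `…/b2b-balaban-t4-ne2-p3/king-renders/…-p013-x2.png`
(p. 661), `…/b2b-balaban-template/king-renders/…-p016-x2.png`, `…-p017-x2.png` (pp. 664–665).

THE PRINT.  p. 665, verbatim: *«The operator (3.46) can be replaced using the following bound:
|U(B(Γ^{(k+n)}_{x₀,x′})) − U(B(Γ^{(k)}_{x₀,x}))| ≤ Ce(L^kε)^{2−d/2}L^{−k} p(L^kε)/(μ₀L^kε). (3.72)»*; p. 661: *«Let B be the value of A_k at some point x₀ in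
□′»* (a CONSTANT vector field), (3.46) *«U(B(Γ^{(k)}_{x₀,v_j})) = exp[e(L^kε)^{2−d/2}qB(Γ^{(k)}_{x₀,v_j})]»*; p. 653 (2.12) (verbatim in part Κ-a): the block
contour `Γ^{(k)}_{y,x} = Γ_{y,x_{k−1}} ∪ … ∪ Γ_{x_1,x}` through the intermediate block sites, straight staircases with INCREASING coordinates, `A(Γ) = Σ_{b∈Γ} εA_b`,
`U(A(Γ)) = exp[eqA(Γ)]`; p. 655 (3.2)₁ *«|A_{k,μ}(y)| ≤ p(L^{k−1}ε)(μ₀L^{k−1}ε)^{−1}»*, (3.1) *«p(ε) = b₀(1 + log ε^{−1})^p»*; p. 664 *«When x′ ∈ T_{η′}, we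
denote by x that point in T_η for which x′ ∈ B^n(x)»*.  (3.72) is the ONLY background-LIVE two-spacing difference written in §3.3 (Props. 3.8∕3.9 are
`A = 0` statements, p. 670); the schema `King1986.SlicePropagator.Ineq372Printed` (typer, `SlicePropagatorStatements` §3) had no inhabitant in the tree.

WHY (3.72) HOLDS (the proof typed here).  By (2.12) the contours are NESTED, `Γ^{(k+n)}_{x₀,x′} = Γ^{(k)}_{x₀,x} ∪ Γ^{(n)}_{x,x′}` with the coarse
`η`-bonds subdivided into `L^n` `η′`-bonds (part Κ-a `blockContour_nested`, a LIST identity); for the constant `B`, `B(Γ) = Σ_{b∈Γ} ηB_b` is additive and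
subdivision-invariant, so `B(Γ^{(k+n)}) − B(Γ^{(k)}) = B(Γ^{(n)}_{x,x′})`, `|B(Γ^{(n)}_{x,x′})| ≤ η′‖B‖_∞·dL^n = dη‖B‖_∞`; with `q = i` the dressings are
unimodular and `|e^{iθ′} − e^{iθ}| ≤ |θ′ − θ|`, whence `|U′ − U| ≤ e(L^kε)^{2−d∕2}dL^{−k}·p(L^{k−1}ε)(μ₀L^{k−1}ε)^{−1} ≤ [dL(1 + log L)^p]·(r.h.s. of (3.72))`
(`p(L^{k−1}ε) ≤ (1 + log L)^p·p(L^kε)` for `L^kε ≤ 1`).  The unit-lattice head `Γ_{x₀,y}` (same block for `x`, `x′`: `blockOf_kingSlicePt`) cancels; it is an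
arbitrary phase `h(y)`.

WHAT THIS FILE PROVES (namespace `…N15KingModelRung.Curved`; carriers `T_η = Tor (fine (L^K) M)`, `T_{η′} = Tor (fine (L^{K+n}) M)`, pairing `kingSlicePt`
of parts Χ-a ∕ Ω₁; step-list contours of part Κ-a).
* §1 ON THE TORI: `kingBlockContour` (King's `Γ^{(K)}_{y,x}`, `y` = base point of the unit block), ★★ `kingBlockContour_nested` (via `val_kingSlicePt`),
  `kingContourPhase` (`B(Γ^{(K)}_{y,x})`, `η = L^{−K}`), `kingContourPhase_eq_offset` (`= B·(x − y)`), `tailPhase`, ★★ `kingContourPhase_nested`,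
  `abs_tailPhase_le` (`≤ (d+1)‖B‖_∞L^{−K}`), `blockOf_kingSlicePt`.
* §2 THE DRESSING (3.46) `kingDressing L K M e s h B x = exp[i·e·s·(h(y) + B(Γ^{(K)}_{y,x}))]` (`s = (L^kε)^{2−d∕2}`): `norm_kingDressing = 1`,
  `norm_cexp_I_sub_cexp_I_le`, ★★ `norm_kingDressing_sub_le`, `pFn_div_le`, and ★★★ **`ineq372Printed_king`**:
  `Ineq372Printed (d+1) (kingSlicePt L K n M) U U′ L K e μ₀ (L^kε) b₀ p ((d+1)·L·(1 + log L)^p)` for EVERY `K, n, M`, head `h`, constant `B` under (3.2)₁ —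
  King's (3.72) with `C = d·L·(1 + log L)^p` (`d` = dimension; uniform in `k, n, ε`, volume); `kingDressing_sub_eq_zero_of_field_zero` (`A = 0`: difference `0`);
  ★★ `ineq372Printed_king_record` (the same on the Ω₁ record's pairing `(kingTwoSpacingFull L a m² j n).pt` — (3.71), (3.72), (3.73) BY NAME on ONE system).
* §3 `kingDressing_eq_prod` (the U(1) dressing IS the ordered product along `Γ^{(K)}_{y,x}`, so part Κ-a's `norm_prod_append_sub_prod_le` is the mechanism and
  uses no commutativity), ★★ `norm_headedProd_kingBlockContour_nested_sub_le`: THE SHAPE OF (3.72) on the tori for NON-COMMUTING bond transporters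
  (`‖U_s‖ ≤ 1`, `‖U_s − 1‖ ≤ θ`, coarse bond = `L^n`-th power, heads of norm `≤ 1`): `≤ (d+1)·L^n·θ` — WHAT THE CURVED CASE ADDS at the dressing is carried by
  the NESTING of (2.12), curvature `[B_μ, B_ν] ≠ 0` of a constant background notwithstanding.  (TIGHTNESS of the rate `L^{−k}`: part Κ-c `…ContourPhaseTight`.)

HONEST SCOPE.  (i) `B` constant (as printed, p. 661) with (3.2)₁ AS THE HYPOTHESIS `|B_μ| ≤ p(L^kε∕L)(μ₀L^kε∕L)^{−1}`; `q = i` (charge one); `0 ≤ e`, `0 < μ₀`,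
`0 < L^kε ≤ 1`, `b₀, p ≥ 0`, `L ≥ 1`.  (ii) The head `Γ_{x₀,y}` of King's contour on the unit lattice is an ARBITRARY real phase `h(y)` per unit block (any
contour choice; it cancels).  (iii) The contour enters `U` through `B(Γ)` only (abelian print); the step LISTS are typed and the nesting is a LIST identity, but
no plaquette ∕ curvature object is built; §3's mechanism lemma is over an abstract normed ring, not a statement about Bałaban's `G(U)`.  N15 NOT discharged by
this file; counts unmoved.
Locators: [King1986] (2.10)–(2.12) p.653, (3.1)–(3.2) p.655, (3.43)–(3.46) p.661, p.664 (pairing), (3.72) p.665, p.670 (A = 0 in §4).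
-/

noncomputable section

namespace Summit.QuantumFields.YangMills.BalabanUVNodes.N15KingModelRung.Curved

open scoped BigOperators
open Literature.MathematicalPhysics.QuantumFieldTheory.Balaban1983to89.B5Prop11Plancherel (Tor fine)
open Literature.MathematicalPhysics.QuantumFieldTheory.Balaban1983to89.B2 (pFn)
open Literature.MathematicalPhysics.QuantumFieldTheory.King1986.Torus (blockOf val_blockOf)
open Literature.MathematicalPhysics.QuantumFieldTheory.King1986.SlicePropagator (Ineq372Printed)
open Summit.QuantumFields.YangMills.BalabanUVNodes.N15KingModelRung (KingVolIndex kingVol kingVol_neZero)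
open Summit.QuantumFields.YangMills.BalabanUVNodes.N15KingModelRung.Contour

/-! ## §1 On the rung's two-spacing tori: King's `Γ^{(K)}_{y,x}` for `x ∈ T_η`, the phase `B(Γ)`, nesting through the pairing `kingSlicePt` -/

section Torus

variable {d : ℕ} (L : ℕ)

/-- **KING's CONTOUR `Γ^{(K)}_{y,x}` ON `T_η = Tor (fine (L^K) M)`** (`η = L^{−K}`; `y` = the base point of the unit block of `x`): the block staircase (2.12) of
the fine coordinates of `x`. [cite: King1986, (2.12) p.653] -/
def kingBlockContour (K : ℕ) (M : Fin (d + 1) → ℕ) (x : Tor (fine (L ^ K) M)) : List (ContourStep (d + 1)) :=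
  blockContour L K fun μ => (x μ).val

/-- ★★ **NESTING ON THE TORI**: `Γ^{(K+n)}_{y,x′} = [Γ^{(K)}_{y,x} subdivided by L^n] ++ Γ^{(n)}_{x,x′}` with `x = kingSlicePt x′` (King's `x′ ∈ B^n(x)`).
[cite: King1986, (2.12) p.653, p.664 (pairing)] -/
theorem kingBlockContour_nested [NeZero L] (K n : ℕ) (M : Fin (d + 1) → ℕ) [∀ μ, NeZero (M μ)] (x' : Tor (fine (L ^ (K + n)) M)) :
    kingBlockContour L (K + n) M x'
      = subdivide (L ^ n) (kingBlockContour L K M (kingSlicePt L K n M x')) ++ blockContour L n fun μ => (x' μ).val := by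
  unfold kingBlockContour
  rw [blockContour_nested]
  congr 3
  funext μ
  rw [val_kingSlicePt]

/-- **KING's PHASE `B(Γ^{(K)}_{y,x}) = Σ_{b∈Γ} ηB_b`**, `η = L^{−K}`, for the constant field `B`. [cite: King1986, (2.12) p.653, (3.46) p.661] -/
def kingContourPhase (K : ℕ) (M : Fin (d + 1) → ℕ) (B : Fin (d + 1) → ℝ) (x : Tor (fine (L ^ K) M)) : ℝ :=
  contourSum (((L : ℝ) ^ K)⁻¹) B (kingBlockContour L K M x)

/-- `B(Γ^{(K)}_{y,x}) = L^{−K}·Σ_μ (x_μ mod L^K)·B_μ` — `B` dotted into the continuum offset of `x` in its unit block. [cite: King1986, (2.12) p.653, (3.46) p.661] -/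
theorem kingContourPhase_eq_offset (K : ℕ) (M : Fin (d + 1) → ℕ) (B : Fin (d + 1) → ℝ) (x : Tor (fine (L ^ K) M)) :
    kingContourPhase L K M B x = ((L : ℝ) ^ K)⁻¹ * ∑ μ, (((x μ).val % L ^ K : ℕ) : ℝ) * B μ := by
  unfold kingContourPhase kingBlockContour
  exact contourSum_blockContour _ _ _ _ _

/-- THE TAIL PHASE `B(Γ^{(n)}_{x,x′})` on the `η′`-lattice (`η′ = L^{−(K+n)}`). [cite: King1986, (2.12) p.653, p.664] -/
def tailPhase (K n : ℕ) (M : Fin (d + 1) → ℕ) (B : Fin (d + 1) → ℝ) (x' : Tor (fine (L ^ (K + n)) M)) : ℝ :=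
  contourSum (((L : ℝ) ^ (K + n))⁻¹) B (blockContour L n fun μ => (x' μ).val)

/-- ★★ **ADDITIVITY OF THE PHASE OVER THE NESTED CONTOURS**: `B(Γ^{(K+n)}_{y,x′}) = B(Γ^{(K)}_{y,x}) + B(Γ^{(n)}_{x,x′})`, `x = kingSlicePt x′`.
[cite: King1986, (2.12) p.653, p.664 (pairing), (3.72) p.665] -/
theorem kingContourPhase_nested [NeZero L] (K n : ℕ) (M : Fin (d + 1) → ℕ) [∀ μ, NeZero (M μ)] (B : Fin (d + 1) → ℝ)
    (x' : Tor (fine (L ^ (K + n)) M)) :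
    kingContourPhase L (K + n) M B x' = kingContourPhase L K M B (kingSlicePt L K n M x') + tailPhase L K n M B x' := by
  unfold kingContourPhase tailPhase
  rw [kingBlockContour_nested, contourSum_append, contourSum_subdivide]
  congr 2
  have hL : (L : ℝ) ≠ 0 := by exact_mod_cast NeZero.ne L
  push_cast
  rw [pow_add]
  field_simp

/-- `|B(Γ^{(n)}_{x,x′})| ≤ (d+1)·‖B‖_∞·L^{−K}` — the tail has fewer than `(d+1)L^n` bonds of length `L^{−(K+n)}`. [cite: King1986, (2.12) p.653, (3.72) p.665] -/
theorem abs_tailPhase_le [NeZero L] (K n : ℕ) (M : Fin (d + 1) → ℕ) {B : Fin (d + 1) → ℝ} {β : ℝ} (hβ : 0 ≤ β) (hB : ∀ μ, |B μ| ≤ β)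
    (x' : Tor (fine (L ^ (K + n)) M)) :
    |tailPhase L K n M B x'| ≤ ((d : ℝ) + 1) * β * ((L : ℝ) ^ K)⁻¹ := by
  have hL0 : 0 < L := Nat.pos_of_ne_zero (NeZero.ne L)
  have hLr : (0 : ℝ) < L := by exact_mod_cast hL0
  have hη : (0 : ℝ) ≤ ((L : ℝ) ^ (K + n))⁻¹ := by positivity
  unfold tailPhase
  refine (abs_contourSum_le hη hB _).trans ?_
  have hlen : (((blockContour L n fun μ => (x' μ).val).length : ℕ) : ℝ) ≤ ((d : ℝ) + 1) * (L : ℝ) ^ n := by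
    have := length_blockContour_le L n hL0 (fun μ => (x' μ).val)
    calc (((blockContour L n fun μ => (x' μ).val).length : ℕ) : ℝ) ≤ (((d + 1) * L ^ n : ℕ) : ℝ) := by exact_mod_cast this
      _ = ((d : ℝ) + 1) * (L : ℝ) ^ n := by push_cast; ring
  calc ((L : ℝ) ^ (K + n))⁻¹ * β * ((blockContour L n fun μ => (x' μ).val).length : ℝ)
      ≤ ((L : ℝ) ^ (K + n))⁻¹ * β * (((d : ℝ) + 1) * (L : ℝ) ^ n) := mul_le_mul_of_nonneg_left hlen (mul_nonneg hη hβ)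
    _ = ((d : ℝ) + 1) * β * ((L : ℝ) ^ K)⁻¹ := by rw [pow_add]; field_simp

/-- Over `x′` and under it lies the SAME unit block: `B(kingSlicePt x′) = B(x′)` — hence the same base point `y` and the same head `Γ_{x₀,y}`.
[cite: King1986, p.664 («x′ ∈ B^n(x)»)] -/
theorem blockOf_kingSlicePt [NeZero L] (K n : ℕ) (M : Fin (d + 1) → ℕ) [∀ μ, NeZero (M μ)] (x' : Tor (fine (L ^ (K + n)) M)) :
    blockOf (L ^ K) M (kingSlicePt L K n M x') = blockOf (L ^ (K + n)) M x' := by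
  have hpow : L ^ n * L ^ K = L ^ (K + n) := by rw [pow_add, Nat.mul_comm]
  funext μ
  apply ZMod.val_injective
  rw [val_blockOf, val_blockOf, val_kingSlicePt, Nat.div_div_eq_div_mul, hpow]

end Torus

/-! ## §2 The dressing (3.46) and KING's (3.72) BY NAME on `SlicePropagator.Ineq372Printed` -/

section Dressing

variable {d : ℕ} (L : ℕ) [NeZero L]

/-- **THE BACKGROUND DRESSING (3.46)** `U(B(Γ^{(K)}_{x₀,x})) = exp[e·s·q·B(Γ^{(K)}_{x₀,x})]`, `s = (L^kε)^{2−d∕2}`, `q = i`, for the constant field `B`, King's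
contour = a head `Γ_{x₀,y}` on the unit lattice (ANY choice; its phase `h(y)` per unit block `y`) followed by the block staircase `Γ^{(K)}_{y,x}` (2.12).
[cite: King1986, (3.46) p.661, (2.11)–(2.12) p.653] -/
def kingDressing (K : ℕ) (M : Fin (d + 1) → ℕ) [∀ μ, NeZero (M μ)] (e s : ℝ) (h : Tor M → ℝ) (B : Fin (d + 1) → ℝ) (x : Tor (fine (L ^ K) M)) : ℂ :=
  Complex.exp (Complex.I * ((e * s * (h (blockOf (L ^ K) M x) + kingContourPhase L K M B x) : ℝ) : ℂ))

/-- the dressing is unimodular (`q = i`). [cite: King1986, (3.46) p.661] -/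
theorem norm_kingDressing (K : ℕ) (M : Fin (d + 1) → ℕ) [∀ μ, NeZero (M μ)] (e s : ℝ) (h : Tor M → ℝ) (B : Fin (d + 1) → ℝ) (x : Tor (fine (L ^ K) M)) :
    ‖kingDressing L K M e s h B x‖ = 1 := by
  unfold kingDressing
  exact Complex.norm_exp_I_mul_ofReal _

/-- two unimodular phases differ by at most the difference of their angles: `|e^{iθ′} − e^{iθ}| ≤ |θ′ − θ|`. [folklore] -/
theorem norm_cexp_I_sub_cexp_I_le (θ' θ : ℝ) :
    ‖Complex.exp (Complex.I * (θ' : ℂ)) - Complex.exp (Complex.I * (θ : ℂ))‖ ≤ |θ' - θ| := by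
  have hfac : Complex.exp (Complex.I * (θ' : ℂ)) - Complex.exp (Complex.I * (θ : ℂ))
      = Complex.exp (Complex.I * (θ : ℂ)) * (Complex.exp (Complex.I * ((θ' - θ : ℝ) : ℂ)) - 1) := by
    rw [mul_sub, mul_one, ← Complex.exp_add]
    congr 2
    push_cast
    ring
  rw [hfac, norm_mul, Complex.norm_exp_I_mul_ofReal, one_mul]
  have h := (Real.norm_exp_I_mul_ofReal_sub_one_le (x := θ' - θ))
  rwa [Real.norm_eq_abs] at h

/-- ★★ **THE DRESSINGS AT THE TWO SPACINGS DIFFER BY THE TAIL PHASE ONLY**: `‖U(B(Γ^{(K+n)}_{x₀,x′})) − U(B(Γ^{(K)}_{x₀,x}))‖ ≤ |e·s|·|B(Γ^{(n)}_{x,x′})|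
≤ |e·s|·(d+1)‖B‖_∞L^{−K}`, `x = kingSlicePt x′`. [cite: King1986, (3.72) p.665, (3.46) p.661, (2.12) p.653] -/
theorem norm_kingDressing_sub_le (K n : ℕ) (M : Fin (d + 1) → ℕ) [∀ μ, NeZero (M μ)] (e s : ℝ) (h : Tor M → ℝ)
    {B : Fin (d + 1) → ℝ} {β : ℝ} (hβ : 0 ≤ β) (hB : ∀ μ, |B μ| ≤ β) (x' : Tor (fine (L ^ (K + n)) M)) :
    ‖kingDressing L (K + n) M e s h B x' - kingDressing L K M e s h B (kingSlicePt L K n M x')‖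
      ≤ |e * s| * (((d : ℝ) + 1) * β * ((L : ℝ) ^ K)⁻¹) := by
  unfold kingDressing
  refine (norm_cexp_I_sub_cexp_I_le _ _).trans ?_
  rw [blockOf_kingSlicePt, kingContourPhase_nested, show e * s * (h (blockOf (L ^ (K + n)) M x') +
      (kingContourPhase L K M B (kingSlicePt L K n M x') + tailPhase L K n M B x')) -
      e * s * (h (blockOf (L ^ (K + n)) M x') + kingContourPhase L K M B (kingSlicePt L K n M x')) = (e * s) * tailPhase L K n M B x' by ring,
    abs_mul]
  exact mul_le_mul_of_nonneg_left (abs_tailPhase_le L K n M hβ hB x') (abs_nonneg _)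

omit [NeZero L] in
/-- **`p(L^{k−1}ε) ≤ (1 + log L)^p·p(L^kε)`** for `L ≥ 1`, `0 < L^kε ≤ 1`, `b₀, p ≥ 0` (`p(ε) = b₀(1 + log ε^{−1})^p`, (3.1); `1 + log L + log ε^{−1} ≤
(1 + log L)(1 + log ε^{−1})`). [cite: King1986, (3.1) p.655] -/
theorem pFn_div_le {b₀ p ε : ℝ} (hb : 0 ≤ b₀) (hp : 0 ≤ p) (hL : 1 ≤ L) (hε : 0 < ε) (hε1 : ε ≤ 1) :
    pFn b₀ p (ε / L) ≤ (1 + Real.log L) ^ p * pFn b₀ p ε := by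
  unfold pFn
  have hLr : (1 : ℝ) ≤ L := by exact_mod_cast hL
  have hlogL : 0 ≤ Real.log (L : ℝ) := Real.log_nonneg hLr
  have hlogε : 0 ≤ Real.log ε⁻¹ := Real.log_nonneg (one_le_inv_iff₀.2 ⟨hε, hε1⟩)
  have hsplit : Real.log (ε / L)⁻¹ = Real.log L + Real.log ε⁻¹ := by
    rw [inv_div, Real.log_div (by positivity) hε.ne', Real.log_inv]; ring
  have hbase : 1 + Real.log (ε / L)⁻¹ ≤ (1 + Real.log L) * (1 + Real.log ε⁻¹) := by rw [hsplit]; nlinarith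
  have hbase0 : 0 ≤ 1 + Real.log (ε / L)⁻¹ := by rw [hsplit]; positivity
  calc b₀ * (1 + Real.log (ε / L)⁻¹) ^ p ≤ b₀ * ((1 + Real.log L) * (1 + Real.log ε⁻¹)) ^ p :=
        mul_le_mul_of_nonneg_left (Real.rpow_le_rpow hbase0 hbase hp) hb
    _ = (1 + Real.log L) ^ p * (b₀ * (1 + Real.log ε⁻¹) ^ p) := by
        rw [Real.mul_rpow (by positivity) (by positivity)]; ring

/-- ★★★ **KING 1986 (3.72) BY NAME** on the typer's schema `SlicePropagator.Ineq372Printed`: for EVERY `K, n`, every torus `M`, every head phase `h`, and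
every CONSTANT vector field `B` obeying (3.2)₁ `|B_μ| ≤ p(L^kε∕L)(μ₀L^kε∕L)^{−1}` (King's `B = A_k(x₀)`), the dressings (3.46) along King's nested contours
(2.12) at the two spacings, paired by `x = kingSlicePt x′` (*«x′ ∈ B^n(x)»*), satisfy
`‖U(B(Γ^{(K+n)}_{x₀,x′})) − U(B(Γ^{(K)}_{x₀,x}))‖ ≤ C·e·(L^kε)^{2−d∕2}·L^{−K}·p(L^kε)∕(μ₀L^kε)` with `C = (d+1)·L·(1 + log L)^p` (`d+1` = dimension).
[cite: King1986, (3.72) p.665, (3.46) p.661, (3.2) p.655, (2.12) p.653, p.664 (pairing)] -/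
theorem ineq372Printed_king (K n : ℕ) (M : Fin (d + 1) → ℕ) [∀ μ, NeZero (M μ)] (h : Tor M → ℝ)
    {e μ₀ Lkε b₀ p : ℝ} (he : 0 ≤ e) (hμ₀ : 0 < μ₀) (hε : 0 < Lkε) (hε1 : Lkε ≤ 1) (hb : 0 ≤ b₀) (hp : 0 ≤ p) (hL : 1 ≤ L)
    {B : Fin (d + 1) → ℝ} (hB : ∀ μ, |B μ| ≤ pFn b₀ p (Lkε / L) * (μ₀ * (Lkε / L))⁻¹) :
    Ineq372Printed (d + 1) (kingSlicePt L K n M)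
      (kingDressing L K M e (Lkε ^ ((2 : ℝ) - ((d + 1 : ℕ) : ℝ) / 2)) h B)
      (kingDressing L (K + n) M e (Lkε ^ ((2 : ℝ) - ((d + 1 : ℕ) : ℝ) / 2)) h B)
      L K e μ₀ Lkε b₀ p (((d : ℝ) + 1) * L * (1 + Real.log L) ^ p) := by
  intro x'
  set s : ℝ := Lkε ^ ((2 : ℝ) - ((d + 1 : ℕ) : ℝ) / 2) with hs
  have hs0 : 0 ≤ s := Real.rpow_nonneg hε.le _
  have hLr : (1 : ℝ) ≤ L := by exact_mod_cast hL
  have hL0 : (0 : ℝ) < L := by linarith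
  set β : ℝ := pFn b₀ p (Lkε / L) * (μ₀ * (Lkε / L))⁻¹ with hβdef
  have hpFn0 : 0 ≤ pFn b₀ p (Lkε / L) := by
    unfold pFn
    have : 0 ≤ 1 + Real.log (Lkε / L)⁻¹ := by
      have : 0 ≤ Real.log (Lkε / ↑L)⁻¹ :=
        Real.log_nonneg (one_le_inv_iff₀.2 ⟨by positivity, (div_le_one hL0).2 (hε1.trans hLr)⟩)
      linarith
    positivity
  have hβ0 : 0 ≤ β := mul_nonneg hpFn0 (by positivity)
  refine (norm_kingDressing_sub_le L K n M e s h hβ0 hB x').trans ?_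
  rw [abs_of_nonneg (mul_nonneg he hs0)]
  -- `β ≤ L(1 + log L)^p · p(L^kε)∕(μ₀L^kε)`
  have hβle : β ≤ (L : ℝ) * (1 + Real.log L) ^ p * (pFn b₀ p Lkε / (μ₀ * Lkε)) := by
    have h1 := pFn_div_le L hb hp hL hε hε1
    have hinv : (μ₀ * (Lkε / L))⁻¹ = (L : ℝ) / (μ₀ * Lkε) := by field_simp
    rw [hβdef, hinv]
    calc pFn b₀ p (Lkε / ↑L) * (↑L / (μ₀ * Lkε)) ≤ (1 + Real.log ↑L) ^ p * pFn b₀ p Lkε * (↑L / (μ₀ * Lkε)) :=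
          mul_le_mul_of_nonneg_right h1 (by positivity)
      _ = ↑L * (1 + Real.log ↑L) ^ p * (pFn b₀ p Lkε / (μ₀ * Lkε)) := by ring
  have hK : (0 : ℝ) < (L : ℝ) ^ K := by positivity
  calc e * s * ((↑d + 1) * β * ((L : ℝ) ^ K)⁻¹) = (e * s * (↑d + 1) * ((L : ℝ) ^ K)⁻¹) * β := by ring
    _ ≤ (e * s * (↑d + 1) * ((L : ℝ) ^ K)⁻¹) * ((L : ℝ) * (1 + Real.log L) ^ p * (pFn b₀ p Lkε / (μ₀ * Lkε))) :=
        mul_le_mul_of_nonneg_left hβle (by positivity)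
    _ = (↑d + 1) * ↑L * (1 + Real.log ↑L) ^ p * e * s * ((L : ℝ) ^ K)⁻¹ * (pFn b₀ p Lkε / (μ₀ * Lkε)) := by ring

/-- at `B = 0` (the `A = 0` member) both dressings are the head phase and the difference VANISHES — the `U ≡ 1` twin. [cite: King1986, (3.72) p.665, p.670 («A = 0»)] -/
theorem kingDressing_sub_eq_zero_of_field_zero (K n : ℕ) (M : Fin (d + 1) → ℕ) [∀ μ, NeZero (M μ)] (e s : ℝ) (h : Tor M → ℝ)
    (x' : Tor (fine (L ^ (K + n)) M)) :
    kingDressing L (K + n) M e s h (fun _ => 0) x' - kingDressing L K M e s h (fun _ => 0) (kingSlicePt L K n M x') = 0 := by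
  have h0 : ∀ (K' : ℕ) (y : Tor (fine (L ^ K') M)), kingContourPhase L K' M (fun _ => (0 : ℝ)) y = 0 := by
    intro K' y; rw [kingContourPhase_eq_offset]; simp
  unfold kingDressing
  rw [h0, h0, blockOf_kingSlicePt, sub_self]

/-- ★★ **(3.72) BY NAME ON THE PAIRING OF THE Ω₁ RECORD** `kingTwoSpacingFull L a m² j n` (whose `pt` IS `kingSlicePt`, `kingTwoSpacingFull_pt`): King's
(3.71) (Prop. 3.8, dag-n15-d by name), (3.73) (Prop. 3.9) and (3.72) now live on ONE two-spacing system of the rung. [cite: King1986, (3.71) p.664, (3.72)–(3.73) p.665] -/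
theorem ineq372Printed_king_record (a msq : ℝ) (j : KingVolIndex d) (n : ℕ) (h : Tor (kingVol L j) → ℝ)
    {e μ₀ Lkε b₀ p : ℝ} (he : 0 ≤ e) (hμ₀ : 0 < μ₀) (hε : 0 < Lkε) (hε1 : Lkε ≤ 1) (hb : 0 ≤ b₀) (hp : 0 ≤ p) (hL : 1 ≤ L)
    {B : Fin (d + 1) → ℝ} (hB : ∀ μ, |B μ| ≤ pFn b₀ p (Lkε / L) * (μ₀ * (Lkε / L))⁻¹) :
    haveI := kingVol_neZero L j
    Ineq372Printed (d + 1) (kingTwoSpacingFull L a msq j n).pt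
      (kingDressing L j.K (kingVol L j) e (Lkε ^ ((2 : ℝ) - ((d + 1 : ℕ) : ℝ) / 2)) h B)
      (kingDressing L (j.K + n) (kingVol L j) e (Lkε ^ ((2 : ℝ) - ((d + 1 : ℕ) : ℝ) / 2)) h B)
      L j.K e μ₀ Lkε b₀ p (((d : ℝ) + 1) * L * (1 + Real.log L) ^ p) := by
  haveI := kingVol_neZero L j
  exact ineq372Printed_king L j.K n (kingVol L j) h he hμ₀ hε hε1 hb hp hL hB

end Dressing

/-! ## §3 The dressing as an ordered product along King's contour; the shape of (3.72) for non-commuting transporters -/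

section Ordered

variable {d : ℕ} (L : ℕ) [NeZero L]

/-- **THE U(1) DRESSING IS THE ORDERED PRODUCT** of the head phase and the bond transporters along King's block contour — so §4's nesting lemma applies to
it verbatim (and would apply unchanged to non-commuting transporters). [cite: King1986, (3.46) p.661, (2.11)–(2.12) p.653] -/
theorem kingDressing_eq_prod (K : ℕ) (M : Fin (d + 1) → ℕ) [∀ μ, NeZero (M μ)] (e s : ℝ) (h : Tor M → ℝ) (B : Fin (d + 1) → ℝ) (x : Tor (fine (L ^ K) M)) :
    kingDressing L K M e s h B x
      = Complex.exp (Complex.I * ((e * s * h (blockOf (L ^ K) M x) : ℝ) : ℂ))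
          * ((kingBlockContour L K M x).map (stepTransporter e s (((L : ℝ) ^ K)⁻¹) B)).prod := by
  rw [kingDressing, ← cexp_contourSum_eq_prod, ← Complex.exp_add, kingContourPhase]
  congr 1
  push_cast
  ring


/-- ★★ **THE SHAPE OF (3.72) ON THE RUNG's TORI WITHOUT COMMUTATIVITY** (part Κ-a `norm_headed_prod_nested_sub_le` at `x = kingSlicePt x′`): for bond
transporters `U_s` on the `η′`-lattice in ANY normed ring with `‖U_s‖ ≤ 1`, `‖U_s − 1‖ ≤ θ` (a constant, possibly NON-COMMUTING background — curvature
`[B_μ, B_ν] ≠ 0` allowed; the coarse `η`-bond transporter is the `L^n`-th power) and unit-lattice heads `g(y)` of norm `≤ 1`, the dressings along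
`Γ^{(K+n)}_{x₀,x′}` and `Γ^{(K)}_{x₀,x}` differ by `≤ (d+1)·L^n·θ` (`= (d+1)·e·s·‖B‖_∞·L^{−K}` at `θ = e·s·L^{−(K+n)}‖B‖_∞`, the abelian (3.72) verbatim).
[cite: King1986, (3.72) p.665, (2.12) p.653, p.664 (pairing)] -/
theorem norm_headedProd_kingBlockContour_nested_sub_le {R : Type*} [NormedRing R] [NormOneClass R] (K n : ℕ) (M : Fin (d + 1) → ℕ) [∀ μ, NeZero (M μ)]
    (U : ContourStep (d + 1) → R) (hU : ∀ s, ‖U s‖ ≤ 1) {θ : ℝ} (hθ0 : 0 ≤ θ) (hθ : ∀ s, ‖U s - 1‖ ≤ θ) (g : Tor M → R) (hg : ∀ y, ‖g y‖ ≤ 1)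
    (x' : Tor (fine (L ^ (K + n)) M)) :
    ‖g (blockOf (L ^ (K + n)) M x') * ((kingBlockContour L (K + n) M x').map U).prod
        - g (blockOf (L ^ K) M (kingSlicePt L K n M x')) * ((kingBlockContour L K M (kingSlicePt L K n M x')).map fun s => U s ^ L ^ n).prod‖
      ≤ ((d : ℝ) + 1) * (L : ℝ) ^ n * θ := by
  have hL0 : 0 < L := Nat.pos_of_ne_zero (NeZero.ne L)
  rw [blockOf_kingSlicePt]
  unfold kingBlockContour
  have hv : (fun μ => (kingSlicePt L K n M x' μ).val) = fun ν => (x' ν).val / L ^ n := by funext μ; rw [val_kingSlicePt]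
  rw [hv]
  have h := norm_headed_prod_nested_sub_le U hU hθ0 hθ (g (blockOf (L ^ (K + n)) M x')) (hg _) L K n hL0 (fun μ => (x' μ).val)
  calc _ ≤ ((d + 1 : ℕ) : ℝ) * (L : ℝ) ^ n * θ := h
    _ = ((d : ℝ) + 1) * (L : ℝ) ^ n * θ := by push_cast; ring

end Ordered

end Summit.QuantumFields.YangMills.BalabanUVNodes.N15KingModelRung.Curved

end
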